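import Summits.QuantumFields.YangMills.Theorems.AllWindowsColdBoxBoxHighLineTiltUParitySizes

/-!
# T-S5.13K-U, SLOTS — the `U`-moments of ✓`Tilt.abs_tiltCum3_muD_zero_chartPlaqCost_le` / ✓`Tilt.abs_tiltCum4_muD_le` IN THEIR OWN LETTERS
# (`E_0[(U_e − E_0 U_e)²]`, `E_0[U_o²]`, `E_0[(U − b)²]` over `μ_D`; ASSEMBLY-S5 §6 (e4)/(e5), E2-memo steps 3–4; LINE-19 S5 ⟨stmt-QuantumFields-24004⟩)

LEAD's (e4) bound (✓p744941) is stated with `μ_D := (volume.restrict (smallField H s)).withDensity (ofReal ∘ gaussWeight β H)`, the GENERIC parity parts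
`Ue a := (tiltU β H a + tiltU β H (−a))/2`, `Uo a := (tiltU β H a − tiltU β H (−a))/2`, and `Z`-slots `tiltExp μ_D (tiltU β H) 0 (fun a => (Ue a − E_0 Ue)²)`,
`tiltExp μ_D (tiltU β H) 0 (fun a => Uo a ^ 2)`.  This file turns ✓`gaussAvg_sfInd_mul_sq_tiltU_parity_le` (numerators `E₀[1_D·…]`) into exactly those:
`E_0[Y] = E₀[1_D Y]/E₀[1_D] ≤ 2·E₀[1_D Y]` when `E₀[1_D] ≥ 1/2` (✓6g), and the centring at the `μ_D`-mean costs nothing by variance minimality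
(w5's ✓`Tilt.tiltExp_centredSq_le`, applied to the TRUNCATED `1_D·Ue` — bounded everywhere — and transported by ✓13u `Tilt.tiltExp_congr_ae`; at `t = 0`
the tilt exponent is immaterial, ✓`Tilt.tiltExp_zero`).

* `tiltExp_muD_zero_le_two_mul` — `0 ≤ Y`, `E₀[1_D] ≥ 1/2` ⇒ `tiltExp μ_D U 0 Y ≤ 2·E₀[1_D·Y]`;
* ★★`tiltExp_muD_zero_tiltU_slots_le` — `∃ C c₀ m, 0 < c₀ ∧ ∀ H ≥ 1, β ≥ H⁴, 0 < s ≤ 1, s·H² ≤ c₀, E₀[1_D] ≥ 1/2:`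
  `E_0[(Ue − E_0 Ue)²] ≤ C(1+log H)^m(H⁸/β² + H¹²s⁶ + H⁸s⁸)`, `E_0[Uo²] ≤ C(1+log H)^m(H⁴/β + H¹²s⁶ + H⁸s⁸)`, `∃ b, E_0[(U − b)²] ≤ C(1+log H)^m(H⁴/β + H¹²s⁶ + H⁸s⁸)`.

Mathlib + tree (✓TiltUParitySizes → 13u/13K-U/13s/13n/LEAD's parity files); no definitions.  HONEST LABEL: support sizes of the OPEN assembly T-S5.13 of the XL stub S5 of a
critic-PASSed DRAFT line; S5, U5, ⟨24004⟩ ⟨24335⟩ ⟨24336⟩ remain OPEN; route AllWindowsColdBox is DRAFT; no rung is proved; **the Yang–Mills mass gap is NOT proved by this file;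
no summit is proved by a line.**  Seat ym-line-fcl-p3 g26 (cell ym-idea-1).
-/

set_option autoImplicit false

noncomputable section

open MeasureTheory

namespace Summit.QuantumFields.YangMills.Theorems.AllWindowsColdBoxBoxHighLine

namespace GaussNormalForm

open EdgeChartGaussian (gaussAvg_nonneg)

variable {H : ℕ} {β : ℝ}

/-- `E_0[Y] ≤ 2·E₀[1_D·Y]` for `Y ≥ 0` once `E₀[1_D] ≥ 1/2`. -/
theorem tiltExp_muD_zero_le_two_mul (hβ : 0 < β) (s : ℝ) (U : (LandauFree H → E3) → ℝ) {Y : (LandauFree H → E3) → ℝ} (hY : ∀ a, 0 ≤ Y a)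
    (hD : 1 / 2 ≤ gaussAvg β H (sfInd H s)) :
    Tilt.tiltExp (((volume : Measure (LandauFree H → E3)).restrict (smallField H s)).withDensity fun a => ENNReal.ofReal (gaussWeight β H a)) U 0 Y ≤
      2 * gaussAvg β H (fun a => sfInd H s a * Y a) := by
  rw [Tilt.tiltExp_muD_zero_eq H hβ s U Y]
  have hnum : 0 ≤ gaussAvg β H (fun a => sfInd H s a * Y a) :=
    gaussAvg_nonneg H hβ fun a => mul_nonneg (by unfold sfInd; exact Set.indicator_nonneg (fun _ _ => zero_le_one) _) (hY a)
  have hDpos : 0 < gaussAvg β H (sfInd H s) := lt_of_lt_of_le (by norm_num) hD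
  rw [div_le_iff₀ hDpos]
  nlinarith

/-- ★★ **The `U`-slots of (e4)/(e5) in the assembler's letters.**  There are `C, c₀ > 0, m` such that for `H ≥ 1`, `β ≥ H⁴`, `0 < s ≤ 1`, `s·H² ≤ c₀` and
`E₀[1_{smallField H s}] ≥ 1/2`, with `μ_D`, `Ue`, `Uo` as above:
`E_0[(Ue − E_0 Ue)²] ≤ C(1+log H)^m(H⁸/β² + H¹²s⁶ + H⁸s⁸)`, `E_0[Uo²] ≤ C(1+log H)^m(H⁴/β + H¹²s⁶ + H⁸s⁸)` and `∃ b, E_0[(U − b)²] ≤ C(1+log H)^m(H⁴/β + H¹²s⁶ + H⁸s⁸)`. -/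
theorem tiltExp_muD_zero_tiltU_slots_le :
    ∃ C c₀ : ℝ, ∃ m : ℕ, 0 < c₀ ∧ ∀ H : ℕ, 1 ≤ H → ∀ β : ℝ, (H : ℝ) ^ 4 ≤ β → ∀ s : ℝ, 0 < s → s ≤ 1 → s * (H : ℝ) ^ 2 ≤ c₀ →
      1 / 2 ≤ gaussAvg β H (sfInd H s) →
      Tilt.tiltExp (((volume : Measure (LandauFree H → E3)).restrict (smallField H s)).withDensity fun a => ENNReal.ofReal (gaussWeight β H a)) (tiltU β H) 0
          (fun a => ((tiltU β H a + tiltU β H (-a)) / 2 -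
            Tilt.tiltExp (((volume : Measure (LandauFree H → E3)).restrict (smallField H s)).withDensity fun a => ENNReal.ofReal (gaussWeight β H a)) (tiltU β H) 0
              (fun a => (tiltU β H a + tiltU β H (-a)) / 2)) ^ 2) ≤
          C * (1 + Real.log H) ^ m * ((H : ℝ) ^ 8 / β ^ 2 + (H : ℝ) ^ 12 * s ^ 6 + (H : ℝ) ^ 8 * s ^ 8) ∧
      Tilt.tiltExp (((volume : Measure (LandauFree H → E3)).restrict (smallField H s)).withDensity fun a => ENNReal.ofReal (gaussWeight β H a)) (tiltU β H) 0
          (fun a => ((tiltU β H a - tiltU β H (-a)) / 2) ^ 2) ≤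
          C * (1 + Real.log H) ^ m * ((H : ℝ) ^ 4 / β + (H : ℝ) ^ 12 * s ^ 6 + (H : ℝ) ^ 8 * s ^ 8) ∧
      ∃ b : ℝ, Tilt.tiltExp (((volume : Measure (LandauFree H → E3)).restrict (smallField H s)).withDensity fun a => ENNReal.ofReal (gaussWeight β H a)) (tiltU β H) 0
          (fun a => (tiltU β H a - b) ^ 2) ≤
          C * (1 + Real.log H) ^ m * ((H : ℝ) ^ 4 / β + (H : ℝ) ^ 12 * s ^ 6 + (H : ℝ) ^ 8 * s ^ 8) := by
  obtain ⟨C, c₀, m, hc₀, h⟩ := gaussAvg_sfInd_mul_sq_tiltU_parity_le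
  obtain ⟨CT, cT, mT, hcT, hT⟩ := TiltSup.abs_tiltU_le_of ghostTaylor
  refine ⟨2 * C, min c₀ cT, m, lt_min hc₀ hcT, fun H hH β hβ s hs0 hs1 hsH hD => ?_⟩
  have hH' : (1 : ℝ) ≤ H := by exact_mod_cast hH
  have hβpos : 0 < β := lt_of_lt_of_le (by positivity) hβ
  obtain ⟨b, heven, hodd, hfull⟩ := h H hH β hβ s hs0.le hs1 (hsH.trans (min_le_left _ _))
  have hsT : s * (H : ℝ) ^ 2 ≤ cT := hsH.trans (min_le_right _ _)
  haveI := Tilt.isFiniteMeasure_muD H hβpos s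
  haveI := neZero_muD (H := H) hβpos hs0
  -- the even part, its truncation, its bound on `D`
  obtain ⟨Ue, hUe⟩ : ∃ Ue : (LandauFree H → E3) → ℝ, ∀ a, Ue a = (tiltU β H a + tiltU β H (-a)) / 2 := ⟨_, fun _ => rfl⟩
  have hUefun : (fun a => (tiltU β H a + tiltU β H (-a)) / 2) = Ue := funext fun a => (hUe a).symm
  set B : ℝ := CT * (1 + Real.log H) ^ mT * (|β| * (H : ℝ) ^ 4 * s ^ 3 + (H : ℝ) ^ 6 * s ^ 2) with hB
  have hB0 : 0 ≤ B := (abs_nonneg _).trans (hT H hH β s hs0.le hs1 hsT 0 (fun e => by rw [Pi.zero_apply, norm_zero]; exact hs0.le))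
  have hUeb : ∀ a ∈ smallField H s, |Ue a| ≤ B := by
    intro a ha
    have h1 := hT H hH β s hs0.le hs1 hsT a ha
    have h2 := hT H hH β s hs0.le hs1 hsT (-a) ((EdgeChartGaussian.neg_mem_smallField_iff s a).2 ha)
    rw [hUe a, abs_div, abs_two]
    have := abs_add_le (tiltU β H a) (tiltU β H (-a))
    linarith
  have hUem : Measurable Ue := by
    rw [← hUefun]; exact ((measurable_tiltU β H).add ((measurable_tiltU β H).comp measurable_neg)).div_const 2
  have hGm : Measurable fun a => sfInd H s a * Ue a := (Tilt.measurable_sfInd H s).mul hUem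
  have hGb : ∀ a, |sfInd H s a * Ue a| ≤ B := Tilt.abs_sfInd_mul_le H hB0 hUeb
  have hae : (fun a => sfInd H s a * Ue a) =ᵐ[((volume : Measure (LandauFree H → E3)).restrict (smallField H s)).withDensity fun a => ENNReal.ofReal (gaussWeight β H a)] Ue := by
    filter_upwards [Tilt.ae_muD_mem_smallField H β s] with a ha
    rw [sfInd, Set.indicator_of_mem ha, one_mul]
  rw [hUefun]
  refine ⟨?_, ?_, ⟨b, ?_⟩⟩
  · -- E_0[(Ue − E_0 Ue)²] ≤ E_0[(Ue − b)²] ≤ 2·E₀[1_D (Ue − b)²]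
    -- at `t = 0` the tilt exponent is immaterial
    have hU0 : ∀ G : (LandauFree H → E3) → ℝ,
        Tilt.tiltExp (((volume : Measure (LandauFree H → E3)).restrict (smallField H s)).withDensity fun a => ENNReal.ofReal (gaussWeight β H a)) (tiltU β H) 0 G =
        Tilt.tiltExp (((volume : Measure (LandauFree H → E3)).restrict (smallField H s)).withDensity fun a => ENNReal.ofReal (gaussWeight β H a)) (fun _ => (0 : ℝ)) 0 G :=
      fun G => by rw [Tilt.tiltExp_zero, Tilt.tiltExp_zero]
    set c' : ℝ := Tilt.tiltExp (((volume : Measure (LandauFree H → E3)).restrict (smallField H s)).withDensity fun a => ENNReal.ofReal (gaussWeight β H a))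
      (fun _ => (0 : ℝ)) 0 (fun a => sfInd H s a * Ue a) with hc'
    have hmean : Tilt.tiltExp (((volume : Measure (LandauFree H → E3)).restrict (smallField H s)).withDensity fun a => ENNReal.ofReal (gaussWeight β H a))
        (tiltU β H) 0 Ue = c' := by
      rw [hU0]; exact Tilt.tiltExp_congr_ae Filter.EventuallyEq.rfl hae.symm 0
    have hae1 : (fun a => (Ue a - c') ^ 2) =ᵐ[((volume : Measure (LandauFree H → E3)).restrict (smallField H s)).withDensity fun a => ENNReal.ofReal (gaussWeight β H a)]
        fun a => (sfInd H s a * Ue a - c') ^ 2 := by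
      filter_upwards [hae] with a ha
      rw [ha]
    have hae2 : (fun a => (sfInd H s a * Ue a - b) ^ 2) =ᵐ[((volume : Measure (LandauFree H → E3)).restrict (smallField H s)).withDensity fun a => ENNReal.ofReal (gaussWeight β H a)]
        fun a => (Ue a - b) ^ 2 := by
      filter_upwards [hae] with a ha
      rw [ha]
    have step2 := Tilt.tiltExp_centredSq_le (μ := ((volume : Measure (LandauFree H → E3)).restrict (smallField H s)).withDensity fun a =>
      ENNReal.ofReal (gaussWeight β H a)) (U := fun _ => (0 : ℝ)) measurable_const hGm (fun _ => by rw [abs_zero]) hGb 0 b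
    have step4 := tiltExp_muD_zero_le_two_mul hβpos s (tiltU β H) (Y := fun a => (Ue a - b) ^ 2) (fun a => sq_nonneg _) hD
    have heven' : gaussAvg β H (fun a => sfInd H s a * (Ue a - b) ^ 2) ≤ C * (1 + Real.log H) ^ m * ((H : ℝ) ^ 8 / β ^ 2 + (H : ℝ) ^ 12 * s ^ 6 + (H : ℝ) ^ 8 * s ^ 8) := by
      simp only [hUe]; exact heven
    have hgoal : (fun a => ((tiltU β H a + tiltU β H (-a)) / 2 -
        Tilt.tiltExp (((volume : Measure (LandauFree H → E3)).restrict (smallField H s)).withDensity fun a => ENNReal.ofReal (gaussWeight β H a))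
          (tiltU β H) 0 Ue) ^ 2) =
        fun a => (Ue a - Tilt.tiltExp (((volume : Measure (LandauFree H → E3)).restrict (smallField H s)).withDensity fun a => ENNReal.ofReal (gaussWeight β H a))
          (tiltU β H) 0 Ue) ^ 2 := funext fun a => by rw [hUe a]
    rw [hgoal]
    calc Tilt.tiltExp (((volume : Measure (LandauFree H → E3)).restrict (smallField H s)).withDensity fun a => ENNReal.ofReal (gaussWeight β H a)) (tiltU β H) 0
          (fun a => (Ue a - Tilt.tiltExp (((volume : Measure (LandauFree H → E3)).restrict (smallField H s)).withDensity fun a => ENNReal.ofReal (gaussWeight β H a))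
            (tiltU β H) 0 Ue) ^ 2)
        = Tilt.tiltExp (((volume : Measure (LandauFree H → E3)).restrict (smallField H s)).withDensity fun a => ENNReal.ofReal (gaussWeight β H a)) (fun _ => (0 : ℝ)) 0
            (fun a => (sfInd H s a * Ue a - c') ^ 2) := by
          rw [hmean, hU0]; exact Tilt.tiltExp_congr_ae Filter.EventuallyEq.rfl hae1 0
      _ ≤ Tilt.tiltExp (((volume : Measure (LandauFree H → E3)).restrict (smallField H s)).withDensity fun a => ENNReal.ofReal (gaussWeight β H a)) (fun _ => (0 : ℝ)) 0
            (fun a => (sfInd H s a * Ue a - b) ^ 2) := step2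
      _ = Tilt.tiltExp (((volume : Measure (LandauFree H → E3)).restrict (smallField H s)).withDensity fun a => ENNReal.ofReal (gaussWeight β H a)) (tiltU β H) 0
            (fun a => (Ue a - b) ^ 2) := by
          rw [hU0]; exact Tilt.tiltExp_congr_ae Filter.EventuallyEq.rfl hae2 0
      _ ≤ 2 * gaussAvg β H (fun a => sfInd H s a * (Ue a - b) ^ 2) := step4
      _ ≤ 2 * (C * (1 + Real.log H) ^ m * ((H : ℝ) ^ 8 / β ^ 2 + (H : ℝ) ^ 12 * s ^ 6 + (H : ℝ) ^ 8 * s ^ 8)) := by linarith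
      _ = 2 * C * (1 + Real.log H) ^ m * ((H : ℝ) ^ 8 / β ^ 2 + (H : ℝ) ^ 12 * s ^ 6 + (H : ℝ) ^ 8 * s ^ 8) := by ring
  · have step := tiltExp_muD_zero_le_two_mul hβpos s (tiltU β H) (Y := fun a => ((tiltU β H a - tiltU β H (-a)) / 2) ^ 2) (fun a => sq_nonneg _) hD
    calc _ ≤ _ := step
      _ ≤ 2 * (C * (1 + Real.log H) ^ m * ((H : ℝ) ^ 4 / β + (H : ℝ) ^ 12 * s ^ 6 + (H : ℝ) ^ 8 * s ^ 8)) := by linarith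
      _ = 2 * C * (1 + Real.log H) ^ m * ((H : ℝ) ^ 4 / β + (H : ℝ) ^ 12 * s ^ 6 + (H : ℝ) ^ 8 * s ^ 8) := by ring
  · have step := tiltExp_muD_zero_le_two_mul hβpos s (tiltU β H) (Y := fun a => (tiltU β H a - b) ^ 2) (fun a => sq_nonneg _) hD
    calc _ ≤ _ := step
      _ ≤ 2 * (C * (1 + Real.log H) ^ m * ((H : ℝ) ^ 4 / β + (H : ℝ) ^ 12 * s ^ 6 + (H : ℝ) ^ 8 * s ^ 8)) := by linarith
      _ = 2 * C * (1 + Real.log H) ^ m * ((H : ℝ) ^ 4 / β + (H : ℝ) ^ 12 * s ^ 6 + (H : ℝ) ^ 8 * s ^ 8) := by ring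

end GaussNormalForm

end Summit.QuantumFields.YangMills.Theorems.AllWindowsColdBoxBoxHighLine

end
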